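import Literature.Analysis.FluidPDE.DriftHeatKernelLowerBound
import HarnessLib

/-!
# Scale-free positivity of the Gaussian profile; mass-to-pointwise and inf-to-inf steps

Analysis/FluidPDE proofs file (theorems only), second support file on the discharge path of the
named fact `Literature.Analysis.FluidPDE.Lieberman1996_weak_harnack` (Lieberman 1996, Ch. VI,
Corollary 6.24, weak Harnack inequality with flexible cylinders for `uₜ + a·∇u − Δu = 0` with
bounded measurable drift), continuing `DriftHeatKernelLowerBound`:

* `exists_kernel_window` — the explicit Gaussian profile
  `kSubLow n A (5ρ/8) σ − gaussTail n (3ρ/4) σ` of `kernel_lower_bound` (weight supported in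
  `B̄(c, ρ/4)`, evaluation on `B̄(c, 3ρ/8)`) is, after multiplication by `ρⁿ`, bounded below by a
  positive constant `c₀` for all radii `ρ ≤ ρ₀` and all ages `σ = κρ²` with `κ` in a fixed window
  `[κ₁, κs]` (parabolic scale invariance of the Gaussian part, monotonicity of the drift tilt in
  `ρ`; `κs` also satisfies `2nκs ≤ 9/32`, the monotonicity range of the tail correction);
* `IsDriftHeatSolutionOn.mass_to_pointwise` — for a nonnegative member of the local class on
  `[t_b, t] × B̄(c, ρ)`: `(∫_{B(c,ρ/8)} u(t_b)) · profile(t − t_b) ≤ u(t, x)` on `B̄(c, 3ρ/8)`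
  (`kernel_lower_bound` with the weight `η·u(t_b)`, `η` a smooth bump);
* `IsDriftHeatSolutionOn.inf_step` — consequently a lower bound `μ` of `u(t_b, ·)` on
  `B̄(c, ρ/8)` propagates to the lower bound `μ |B(0,1)| (ρ/8)ⁿ · profile(t − t_b)` on
  `B̄(c, 3ρ/8)` at time `t`.

Chained along a segment and summed over a cover, these give Corollary 6.24 with `σ = 1`
(`ParabolicLocalEstimatesProofs`).

## References

* G. M. Lieberman, *Second Order Parabolic Differential Equations*, World Scientific (1996),
  Ch. VI §6 Theorem 6.18, Corollary 6.24; Ch. II (comparison). [Lieberman1996]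
-/

noncomputable section

open MeasureTheory Set Function Filter Metric Real InnerProductSpace Topology
open scoped Laplacian

namespace Literature.Analysis.FluidPDE

variable {E : Type*} [NormedAddCommGroup E] [InnerProductSpace ℝ E] [FiniteDimensional ℝ E]
  [MeasurableSpace E] [BorelSpace E]

/-! ### Scale-free positivity window for the Gaussian profile -/

section Window

/-- The tilt size at scale `ρ ≤ ρ₀`, radius `5ρ/8`, age `κρ²` with `κ ≤ 1` is at most
`2Aρ₀(n + 2) + 2A²ρ₀²`. [folklore] -/
theorem dkTilt_scale_le {n A ρ ρ₀ κ : ℝ} (hn : 0 ≤ n) (hA : 0 ≤ A) (hρ : 0 < ρ) (hρ₀ : ρ ≤ ρ₀)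
    (hκ1 : κ ≤ 1) :
    dkTilt n A (5 / 8 * ρ) (κ * ρ ^ 2) ≤ 2 * A * ρ₀ * (n + 2) + 2 * A ^ 2 * ρ₀ ^ 2 := by
  unfold dkTilt
  have hρ₀0 : 0 ≤ ρ₀ := hρ.le.trans hρ₀
  have hρ2 : ρ ^ 2 ≤ ρ₀ ^ 2 := pow_le_pow_left₀ hρ.le hρ₀ 2
  have h1 : √((5 / 8 * ρ) ^ 2 + κ * ρ ^ 2) ≤ 2 * ρ₀ := by
    rw [show (2 : ℝ) * ρ₀ = √((2 * ρ₀) ^ 2) by rw [Real.sqrt_sq (by positivity)]]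
    exact Real.sqrt_le_sqrt (by nlinarith [mul_le_mul_of_nonneg_right hκ1 (sq_nonneg ρ)])
  have h2 : √(κ * ρ ^ 2) ≤ ρ₀ := by
    rw [show ρ₀ = √(ρ₀ ^ 2) by rw [Real.sqrt_sq hρ₀0]]
    exact Real.sqrt_le_sqrt (by nlinarith [mul_le_mul_of_nonneg_right hκ1 (sq_nonneg ρ)])
  have h3 : κ * ρ ^ 2 ≤ ρ₀ ^ 2 := by nlinarith [mul_le_mul_of_nonneg_right hκ1 (sq_nonneg ρ)]
  have e1 : A * √((5 / 8 * ρ) ^ 2 + κ * ρ ^ 2) ≤ A * (2 * ρ₀) := mul_le_mul_of_nonneg_left h1 hA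
  have e2 : 2 * (n + 1) * A * √(κ * ρ ^ 2) ≤ 2 * (n + 1) * A * ρ₀ :=
    mul_le_mul_of_nonneg_left h2 (by positivity)
  have e3 : 2 * A ^ 2 * (κ * ρ ^ 2) ≤ 2 * A ^ 2 * ρ₀ ^ 2 := mul_le_mul_of_nonneg_left h3 (by positivity)
  nlinarith

/-- Parabolic rescaling of the heat normalisation: `ρᴺ (4π κρ²)^{-N/2} = (4πκ)^{-N/2}`
(`ρ, κ > 0`). [folklore] -/
theorem pow_mul_heatNorm_scale (N : ℕ) {ρ κ : ℝ} (hρ : 0 < ρ) (hκ : 0 < κ) :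
    ρ ^ N * (4 * π * (κ * ρ ^ 2)) ^ (-(N : ℝ) / 2) = (4 * π * κ) ^ (-(N : ℝ) / 2) := by
  have e0 : (ρ ^ 2) ^ ((N : ℝ) / 2) = ρ ^ N := by
    rw [← Real.rpow_two, ← Real.rpow_mul hρ.le, show (2 : ℝ) * ((N : ℝ) / 2) = (N : ℝ) by ring,
      Real.rpow_natCast]
  have e0' : (ρ ^ 2) ^ (-(N : ℝ) / 2) = (ρ ^ N)⁻¹ := by
    rw [show (-(N : ℝ) / 2) = -((N : ℝ) / 2) by ring, Real.rpow_neg (by positivity), e0]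
  have hρN : ρ ^ N ≠ 0 := pow_ne_zero _ hρ.ne'
  rw [show 4 * π * (κ * ρ ^ 2) = (4 * π * κ) * ρ ^ 2 by ring,
    Real.mul_rpow (by positivity) (by positivity), e0']
  field_simp

/-- **Scale-free positivity window for the Gaussian profile of `kernel_lower_bound`.** For
`A ≥ 0`, `ρ₀ > 0` and dimension `N` there is `κs ∈ (0, 1]` with `2Nκs ≤ 9/32` such that for
every `κ₁ ∈ (0, κs]` there is `c₀ > 0` with
`c₀ ≤ ρᴺ (kSubLow N A (5ρ/8) (κρ²) − gaussTail N (3ρ/4) (κρ²))` for all `ρ ∈ (0, ρ₀]`,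
`κ ∈ [κ₁, κs]`: after rescaling, `ρᴺ·(…) = (4πκ)^{-N/2} e^{-9/(64κ)} (e^{11/(256κ) − dkTilt} − 1)`
and the tilt is bounded by `dkTilt_scale_le`, so the bracket is positive once
`256 κs · tilt < 11`. [folklore] -/
theorem exists_kernel_window (N : ℕ) {A ρ₀ : ℝ} (hA : 0 ≤ A) (hρ₀ : 0 < ρ₀) :
    ∃ κs : ℝ, 0 < κs ∧ κs ≤ 1 ∧ 2 * (N : ℝ) * κs ≤ 9 / 32 ∧
      ∀ κ₁ ∈ Ioc 0 κs, ∃ c₀ : ℝ, 0 < c₀ ∧ ∀ ρ ∈ Ioc 0 ρ₀, ∀ κ ∈ Icc κ₁ κs,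
        c₀ ≤ ρ ^ N * (kSubLow N A (5 / 8 * ρ) (κ * ρ ^ 2) -
          gaussTail N (3 / 4 * ρ) (κ * ρ ^ 2)) := by
  set n : ℝ := (N : ℝ) with hn
  have hn0 : 0 ≤ n := Nat.cast_nonneg _
  set T : ℝ := 2 * A * ρ₀ * (n + 2) + 2 * A ^ 2 * ρ₀ ^ 2 with hT
  have hT0 : 0 ≤ T := by positivity
  set κs : ℝ := min (min 1 (9 / (64 * (n + 1)))) (11 / (256 * (T + 1))) with hκs
  have hκs0 : 0 < κs := lt_min (lt_min one_pos (by positivity)) (by positivity)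
  have hκs1 : κs ≤ 1 := (min_le_left _ _).trans (min_le_left _ _)
  have hκsn : κs ≤ 9 / (64 * (n + 1)) := (min_le_left _ _).trans (min_le_right _ _)
  have hκsT : κs ≤ 11 / (256 * (T + 1)) := min_le_right _ _
  have hκsN : 2 * n * κs ≤ 9 / 32 := by
    have h1 : 2 * n * κs ≤ 2 * n * (9 / (64 * (n + 1))) :=
      mul_le_mul_of_nonneg_left hκsn (by positivity)
    have h2 : 2 * n * (9 / (64 * (n + 1))) ≤ 9 / 32 := by
      rw [show 2 * n * (9 / (64 * (n + 1))) = 9 / 32 * (n / (n + 1)) by field_simp; ring]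
      exact mul_le_of_le_one_right (by norm_num) ((div_le_one (by positivity)).2 (by linarith))
    exact h1.trans h2
  have h256 : 256 * κs * T < 11 := by
    have h1 : 256 * κs * (T + 1) ≤ 11 := by
      have := (le_div_iff₀ (by positivity : (0 : ℝ) < 256 * (T + 1))).1 hκsT
      linarith
    nlinarith
  refine ⟨κs, hκs0, hκs1, hκsN, fun κ₁ hκ₁ => ?_⟩
  set g : ℝ := exp (11 / (256 * κs) - T) - 1 with hg_def
  have hg : 0 < g := by
    rw [hg_def, sub_pos, one_lt_exp_iff, sub_pos, lt_div_iff₀ (by positivity)]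
    linarith
  refine ⟨(4 * π * κs) ^ (-n / 2) * exp (-(9 / (64 * κ₁))) * g, by positivity,
    fun ρ hρ κ hκ => ?_⟩
  have hρ0 : 0 < ρ := hρ.1
  have hκ0 : 0 < κ := hκ₁.1.trans_le hκ.1
  have hσ : 0 < κ * ρ ^ 2 := by positivity
  -- the profile at scale `ρ`
  have e2 : -(5 / 8 * ρ) ^ 2 / (4 * (κ * ρ ^ 2)) = -(25 / (256 * κ)) := by
    field_simp
    ring
  have e3 : -(3 / 4 * ρ) ^ 2 / (4 * (κ * ρ ^ 2)) = -(9 / (64 * κ)) := by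
    field_simp
    ring
  have hk : ρ ^ N * kSubLow n A (5 / 8 * ρ) (κ * ρ ^ 2) = (4 * π * κ) ^ (-n / 2) *
      exp (-(25 / (256 * κ))) * exp (-dkTilt n A (5 / 8 * ρ) (κ * ρ ^ 2)) := by
    unfold kSubLow
    rw [e2, hn, ← pow_mul_heatNorm_scale N hρ0 hκ0]
    ring
  have hgt : ρ ^ N * gaussTail n (3 / 4 * ρ) (κ * ρ ^ 2) =
      (4 * π * κ) ^ (-n / 2) * exp (-(9 / (64 * κ))) := by
    unfold gaussTail
    rw [e3, hn, ← pow_mul_heatNorm_scale N hρ0 hκ0]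
    ring
  have factor : ρ ^ N * (kSubLow n A (5 / 8 * ρ) (κ * ρ ^ 2) - gaussTail n (3 / 4 * ρ) (κ * ρ ^ 2))
      = (4 * π * κ) ^ (-n / 2) * exp (-(9 / (64 * κ))) *
          (exp (11 / (256 * κ) - dkTilt n A (5 / 8 * ρ) (κ * ρ ^ 2)) - 1) := by
    have hexp : exp (-(25 / (256 * κ))) * exp (-dkTilt n A (5 / 8 * ρ) (κ * ρ ^ 2)) =
        exp (-(9 / (64 * κ))) * exp (11 / (256 * κ) - dkTilt n A (5 / 8 * ρ) (κ * ρ ^ 2)) := by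
      rw [← exp_add, ← exp_add]
      congr 1
      field_simp
      ring
    rw [mul_sub, hk, hgt, mul_assoc, hexp]
    ring
  rw [factor]
  -- bounds of the three factors on the window
  have b1 : (4 * π * κs) ^ (-n / 2) ≤ (4 * π * κ) ^ (-n / 2) :=
    Real.rpow_le_rpow_of_nonpos (by positivity) (by nlinarith [hκ.2, pi_pos])
      (by rw [neg_div]; exact neg_nonpos.2 (by positivity))
  have b2 : exp (-(9 / (64 * κ₁))) ≤ exp (-(9 / (64 * κ))) := by
    rw [exp_le_exp, neg_le_neg_iff]
    have hκ₁0 : 0 < κ₁ := hκ₁.1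
    exact div_le_div_of_nonneg_left (by norm_num) (by positivity) (by nlinarith [hκ.1])
  have b3 : g ≤ exp (11 / (256 * κ) - dkTilt n A (5 / 8 * ρ) (κ * ρ ^ 2)) - 1 := by
    rw [hg_def, sub_le_sub_iff_right, exp_le_exp]
    have h1 : 11 / (256 * κs) ≤ 11 / (256 * κ) :=
      div_le_div_of_nonneg_left (by norm_num) (by positivity) (by nlinarith [hκ.2])
    have h2 : dkTilt n A (5 / 8 * ρ) (κ * ρ ^ 2) ≤ T :=
      dkTilt_scale_le hn0 hA hρ0 hρ.2 (hκ.2.trans hκs1)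
    linarith
  exact mul_le_mul (mul_le_mul b1 b2 (by positivity) (by positivity)) b3 hg.le (by positivity)

end Window

/-! ### From the local mass to a pointwise bound, and one step of the chain of infima -/

section Steps

variable {a : ℝ → E → E} {u : ℝ → E → ℝ} {A : ℝ} {S : Set ℝ} {U : Set E}

omit [InnerProductSpace ℝ E] [FiniteDimensional ℝ E] [MeasurableSpace E] [BorelSpace E] in
/-- A product `η · g` of a continuous `η` whose topological support lies in an open set `U` with
a function `g` continuous on `U` is continuous everywhere. [folklore] -/
theorem continuous_mul_of_tsupport_subset_of_continuousOn {η g : E → ℝ} {U : Set E} (hU : IsOpen U)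
    (hη : Continuous η) (hηU : tsupport η ⊆ U) (hg : ContinuousOn g U) :
    Continuous fun z => η z * g z := by
  rw [continuous_iff_continuousAt]
  intro z
  by_cases hz : z ∈ U
  · exact hη.continuousAt.mul (hg.continuousAt (hU.mem_nhds hz))
  · have hz' : z ∉ tsupport η := fun h => hz (hηU h)
    have hev : (fun w => η w * g w) =ᶠ[𝓝 z] fun _ => 0 := by
      have h0 : η =ᶠ[𝓝 z] 0 := notMem_tsupport_iff_eventuallyEq.1 hz'
      filter_upwards [h0] with w hw
      simp [hw]
    exact hev.continuousAt

/-- **Mass-to-pointwise step.** Let `u` be in the local class on `S × U` (`U` open, `A ≥ 0`),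
`[t_b, t] ⊆ S`, `t_b < t`, `B̄(c, ρ) ⊆ U`, `u ≥ 0` on `[t_b, t] × B̄(c, ρ)` and
`2n(t − t_b) < (3ρ/4)²`. Then for `x ∈ B̄(c, 3ρ/8)`:
`(∫_{B(c, ρ/8)} u(t_b)) · (kSubLow n A (5ρ/8) (t − t_b) − gaussTail n (3ρ/4) (t − t_b)) ≤ u(t, x)`
(`kernel_lower_bound` with the weight `η · u(t_b)`, `η` a smooth bump equal to `1` on
`B̄(c, ρ/8)` and supported in `B̄(c, ρ/4)`). [cite: Lieberman1996, Ch. VI Thm 6.18, Cor 6.24 (Gaussian-comparison proof of the lower bound)] -/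
theorem IsDriftHeatSolutionOn.mass_to_pointwise (hu : IsDriftHeatSolutionOn a u A S U)
    (hU : IsOpen U) (hA : 0 ≤ A) {c : E} {ρ t_b t : ℝ} (hρ : 0 < ρ) (hS : Icc t_b t ⊆ S)
    (htb : t_b < t) (hBU : closedBall c ρ ⊆ U)
    (hn : 2 * (Module.finrank ℝ E : ℝ) * (t - t_b) < (3 / 4 * ρ) ^ 2)
    (hpos : ∀ τ ∈ Icc t_b t, ∀ x ∈ closedBall c ρ, 0 ≤ u τ x) :
    ∀ x ∈ closedBall c (3 / 8 * ρ),
      (∫ z in ball c (ρ / 8), u t_b z) * (kSubLow (Module.finrank ℝ E) A (5 / 8 * ρ) (t - t_b) -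
        gaussTail (Module.finrank ℝ E) (3 / 4 * ρ) (t - t_b)) ≤ u t x := by
  intro x hx
  set n : ℝ := (Module.finrank ℝ E : ℝ) with hn_def
  -- the cut-off and the weight
  let η : ContDiffBump c := ⟨ρ / 8, ρ / 4, by positivity, by linarith⟩
  have hηs : tsupport (η : E → ℝ) = closedBall c (ρ / 4) := η.tsupport_eq
  have hηU : tsupport (η : E → ℝ) ⊆ U := by
    rw [hηs]
    exact (closedBall_subset_closedBall (by linarith)).trans hBU
  have hutb : ContinuousOn (u t_b) U := (hu.contDiffOn t_b (hS ⟨le_rfl, htb.le⟩)).continuousOn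
  set h : E → ℝ := fun z => η z * u t_b z with hh_def
  have hh : Continuous h := continuous_mul_of_tsupport_subset_of_continuousOn hU η.continuous hηU hutb
  have hhs : tsupport h ⊆ closedBall c (ρ / 4) := by
    rw [← hηs]
    exact tsupport_mul_subset_left
  have h0 : ∀ z, 0 ≤ h z := by
    intro z
    by_cases hz : z ∈ closedBall c (ρ / 4)
    · exact mul_nonneg η.nonneg
        (hpos t_b ⟨le_rfl, htb.le⟩ z (closedBall_subset_closedBall (by linarith) hz))
    · have : η z = 0 := by
        have hz' : z ∉ tsupport (η : E → ℝ) := by rwa [hηs]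
        exact image_eq_zero_of_notMem_tsupport hz'
      simp [hh_def, this]
  have hhu : ∀ z ∈ closedBall c ρ, h z ≤ u t_b z := fun z hz => by
    have := hpos t_b ⟨le_rfl, htb.le⟩ z hz
    calc h z = η z * u t_b z := rfl
      _ ≤ 1 * u t_b z := mul_le_mul_of_nonneg_right η.le_one this
      _ = u t_b z := one_mul _
  have hx3 : (3 : ℝ) / 8 * ρ ≤ ρ := by linarith
  have hn' : 2 * (Module.finrank ℝ E : ℝ) * (t - t_b) < (ρ - ρ / 4) ^ 2 := by
    rw [show ρ - ρ / 4 = 3 / 4 * ρ by ring]; exact hn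
  have key := hu.kernel_lower_bound hU hA (rs := ρ / 4) (re := 3 / 8 * ρ) (by positivity)
    (by linarith) hx3 hS hBU hn'
    (fun τ hτ z hz => hpos τ hτ z (by
      rw [mem_closedBall, dist_eq_norm, hz])) hh h0 hhs hhu t ⟨htb, le_rfl⟩ x hx
  rw [show 3 / 8 * ρ + ρ / 4 = 5 / 8 * ρ by ring, show ρ - ρ / 4 = 3 / 4 * ρ by ring] at key
  -- compare the masses
  have hmass : ∫ z in ball c (ρ / 8), u t_b z ≤ ∫ z, h z := by
    rw [← integral_indicator measurableSet_ball]
    refine integral_mono ?_ (hh.integrable_of_hasCompactSupport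
      ((isCompact_closedBall c (ρ / 4)).of_isClosed_subset (isClosed_tsupport h) hhs)) ?_
    · refine IntegrableOn.integrable_indicator ?_ measurableSet_ball
      have hc : ContinuousOn (u t_b) (closedBall c ρ) := hutb.mono hBU
      exact (hc.integrableOn_compact (isCompact_closedBall c ρ)).mono_set
        (ball_subset_closedBall.trans (closedBall_subset_closedBall (by linarith)))
    · intro z
      by_cases hz : z ∈ ball c (ρ / 8)
      · rw [indicator_of_mem hz]
        have h1 : η z = 1 := η.one_of_mem_closedBall (ball_subset_closedBall hz)
        simp [hh_def, h1]
      · rw [indicator_of_notMem hz]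
        exact h0 z
  have hm' : 0 ≤ ∫ z in ball c (ρ / 8), u t_b z :=
    setIntegral_nonneg measurableSet_ball fun z hz =>
      hpos t_b ⟨le_rfl, htb.le⟩ z (ball_subset_closedBall.trans
        (closedBall_subset_closedBall (by linarith)) hz)
  rcases le_or_gt 0 (kSubLow n A (5 / 8 * ρ) (t - t_b) - gaussTail n (3 / 4 * ρ) (t - t_b))
    with hbr | hbr
  · exact (mul_le_mul_of_nonneg_right hmass hbr).trans key
  · have hux : 0 ≤ u t x := hpos t ⟨htb.le, le_rfl⟩ x (closedBall_subset_closedBall hx3 hx)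
    exact (mul_nonpos_of_nonneg_of_nonpos hm' hbr.le).trans hux

/-- **One step of the chain of infima.** In the situation of `mass_to_pointwise`, if
`u(t_b, ·) ≥ μ ≥ 0` on `B̄(c, ρ/8)`, then for `x ∈ B̄(c, 3ρ/8)`:
`μ · |B(0,1)| (ρ/8)ᴺ · (kSubLow n A (5ρ/8) (t − t_b) − gaussTail n (3ρ/4) (t − t_b)) ≤ u(t, x)`
(`|B(c, ρ/8)| = (ρ/8)ᴺ |B(0,1)|`). [cite: Lieberman1996, Ch. VI Thm 6.18, Cor 6.24 (Gaussian-comparison proof of the lower bound)] -/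
theorem IsDriftHeatSolutionOn.inf_step (hu : IsDriftHeatSolutionOn a u A S U)
    (hU : IsOpen U) (hA : 0 ≤ A) {c : E} {ρ t_b t : ℝ} (hρ : 0 < ρ) (hS : Icc t_b t ⊆ S)
    (htb : t_b < t) (hBU : closedBall c ρ ⊆ U)
    (hn : 2 * (Module.finrank ℝ E : ℝ) * (t - t_b) < (3 / 4 * ρ) ^ 2)
    (hpos : ∀ τ ∈ Icc t_b t, ∀ x ∈ closedBall c ρ, 0 ≤ u τ x) {μ : ℝ} (hμ : 0 ≤ μ)
    (hμu : ∀ z ∈ closedBall c (ρ / 8), μ ≤ u t_b z) :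
    ∀ x ∈ closedBall c (3 / 8 * ρ),
      μ * (volume (ball (0 : E) 1)).toReal * (ρ / 8) ^ Module.finrank ℝ E *
        (kSubLow (Module.finrank ℝ E) A (5 / 8 * ρ) (t - t_b) -
          gaussTail (Module.finrank ℝ E) (3 / 4 * ρ) (t - t_b)) ≤ u t x := by
  intro x hx
  set n : ℝ := (Module.finrank ℝ E : ℝ) with hn_def
  have key := hu.mass_to_pointwise hU hA hρ hS htb hBU hn hpos x hx
  have hvol : (volume (ball c (ρ / 8))).toReal =
      (ρ / 8) ^ Module.finrank ℝ E * (volume (ball (0 : E) 1)).toReal := by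
    rw [Measure.addHaar_ball_of_pos volume c (by positivity : (0 : ℝ) < ρ / 8), ENNReal.toReal_mul,
      ENNReal.toReal_ofReal (by positivity)]
  have hmass : μ * (volume (ball (0 : E) 1)).toReal * (ρ / 8) ^ Module.finrank ℝ E ≤
      ∫ z in ball c (ρ / 8), u t_b z := by
    have hutb : ContinuousOn (u t_b) U :=
      (hu.contDiffOn t_b (hS ⟨le_rfl, htb.le⟩)).continuousOn
    have hint : IntegrableOn (u t_b) (ball c (ρ / 8)) volume :=
      ((hutb.mono hBU).integrableOn_compact (isCompact_closedBall c ρ)).mono_set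
        (ball_subset_closedBall.trans (closedBall_subset_closedBall (by linarith)))
    have h1 := setIntegral_ge_of_const_le_real (μ := volume) (c := μ) measurableSet_ball
      measure_ball_lt_top.ne
      (fun z hz => hμu z (ball_subset_closedBall hz)) hint
    rw [measureReal_def, hvol] at h1
    calc μ * (volume (ball (0 : E) 1)).toReal * (ρ / 8) ^ Module.finrank ℝ E
        = μ * ((ρ / 8) ^ Module.finrank ℝ E * (volume (ball (0 : E) 1)).toReal) := by ring
      _ ≤ _ := h1
  have hm' : 0 ≤ μ * (volume (ball (0 : E) 1)).toReal * (ρ / 8) ^ Module.finrank ℝ E := by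
    positivity
  rcases le_or_gt 0 (kSubLow n A (5 / 8 * ρ) (t - t_b) - gaussTail n (3 / 4 * ρ) (t - t_b))
    with hbr | hbr
  · exact (mul_le_mul_of_nonneg_right hmass hbr).trans key
  · have hx3 : (3 : ℝ) / 8 * ρ ≤ ρ := by linarith
    have hux : 0 ≤ u t x := hpos t ⟨htb.le, le_rfl⟩ x (closedBall_subset_closedBall hx3 hx)
    exact (mul_nonpos_of_nonneg_of_nonpos hm' hbr.le).trans hux

end Steps

end Literature.Analysis.FluidPDE

end
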